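import Summits.NavierStokesRegularity.NavierStokesRegularity.Theorems.FrozenSignCascadeBoundedEnvelopeContinuationOfLiouvillePM
import Summits.NavierStokesRegularity.NavierStokesRegularity.Theorems.FrozenSignCascadeBoundedEnvelopeContinuationMorreyOfPMDual
import Summits.NavierStokesRegularity.NavierStokesRegularity.Theorems.FrozenSignCascadeBoundedEnvelopeContinuationLiouvilleMorreySmall
import HarnessLib

/-!
# Route FrozenSignCascade · crux `BoundedEnvelopeContinuation` (stmt-NavierStokesRegularity-10579)
# from the Liouville statement on `L^∞_t PM²_x` — reshape r5 of the line `registered`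

Helper file for the crux item (conjunct (B) of route `FrozenSignCascade`); lands `--supports` that
item and proves the registered stub `stub_ofLiouvillePM2` of the reshaped skeleton (lead c5).

**Reshape r5 (lead c5).** The open stub of reshape r4 (lead c4) was the Liouville statement

  (L_PM)  a bounded ancient mild solution `v` (`ν = 1`), jointly smooth and Oseen-mild on
          `(-∞,0) × ℝ³`, with (4) the all-radii Morrey bound `∫_{B_r(y)} ‖v t‖² ≤ M' r` AND
          (5) the dual pseudo-measure bound `|∫ v_l(t) φ| ≤ C' ∫ ‖𝓕φ‖/‖ξ‖²` at all negative
          times, vanishes identically.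

Hypothesis (4) is REDUNDANT: the dual `PM²` bound implies the Morrey bound with
`M' = (54|B₁|³ + 18|B₁|) C'²` (`stub_morreyOfPMDual`, file `…MorreyOfPMDual.lean`: `PM² ⊂ Ṁ^{2,1}`
by Plancherel on `L¹ ∩ L²`). Hence (L_PM) is EQUIVALENT to

  (L_PM2) a bounded ancient mild solution `v` (`ν = 1`), jointly smooth and Oseen-mild on
          `(-∞,0) × ℝ³`, whose slices obey the dual pseudo-measure bound
          `|∫ v_l(t) φ| ≤ C' ∫ ‖𝓕φ(ξ)‖/‖ξ‖² dξ` for all `t < 0` and all admissible real `φ`,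
          vanishes identically

(`liouvillePM2_of_liouvillePM`, `liouvillePM_of_liouvillePM2`), i.e. to the Liouville theorem for
bounded ancient mild solutions in `L^∞_t PM²_x` (Le Jan–Sznitman / Cannone–Karch pseudo-measure
space) — the one statement to hold against the literature. The crux follows from it
(`boundedEnvelopeContinuation_of_liouvillePM2` = registered `stub_ofLiouvillePM2`), every bridge
into (L_M) is a bridge into (L_PM2) (`liouvillePM2_of_liouvilleMorrey`), and (L_PM2) HOLDS for a
small pseudo-measure constant (`liouvillePM2_small`: the Liouville form of the Le Jan–Sznitman /
Cannone–Karch small-data uniqueness, here from lead c3's `liouvilleMorrey_small` through the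
embedding) — so a counterexample to the crux needs a bounded ancient mild solution whose
`L^∞_t PM²_x` norm exceeds a universal threshold. (L_PM2) in general is Type-I exclusion in
Liouville form restricted to `L^∞_t PM²_x` (`PM² ⊂ L^∞_t Ṁ^{2,1}`: the Albritton–Barker Type-I
quantity is finite), open (Barker–Prange 2020, §1.3).

References: G. Koch, N. Nadirashvili, G. Seregin, V. Šverák, Acta Math. 203 (2009) =
arXiv:0709.3599, §1; P. G. Lemarié-Rieusset, *The Navier–Stokes problem in the 21st century*
(2016), §8.5; Y. Le Jan, A. S. Sznitman, Probab. Theory Related Fields 109 (1997); M. Cannone,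
G. Karch, J. Differential Equations 197 (2004), §2; T. Barker, C. Prange, Arch. Ration. Mech.
Anal. 235 (2020), §1.3.
-/

noncomputable section

set_option linter.dupNamespace false -- nested layout Summit.<S>.<Sub>, Sub = S (D-0017)

open Set MeasureTheory Filter Topology Metric Function
open scoped ENNReal FourierTransform
open Literature.Analysis Literature.Analysis.FluidPDE

namespace Summit.NavierStokesRegularity.NavierStokesRegularity.Theorems.BoundedEnvelope

/-! ### (L_PM) and (L_PM2) are equivalent -/

/-- **(L_PM2) ⇒ (L_PM)**: dropping the Morrey hypothesis only strengthens the Liouville statement.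
[folklore] -/
theorem liouvillePM_of_liouvillePM2
    (h2 : ∀ v : ℝ → EuclideanSpace ℝ (Fin 3) → EuclideanSpace ℝ (Fin 3),
      IsBoundedAncientMildSolution 1 v →
      ContDiffOn ℝ (⊤ : ℕ∞) (uncurry v) (Set.Iio 0 ×ˢ Set.univ) →
      (∀ s t : ℝ, s < t → t < 0 → ∀ x,
        v t x = UnboundedOperators.heatExtension (v s) (t - s) x - oseenDuhamel 1 s v v t x) →
      (∃ C' : ℝ, ∀ t < 0, ∀ (l : Fin 3) (φ : EuclideanSpace ℝ (Fin 3) → ℝ), Integrable φ →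
        Integrable (fun ξ : EuclideanSpace ℝ (Fin 3) => ‖𝓕 (fun x => (φ x : ℂ)) ξ‖ / ‖ξ‖ ^ 2) →
        |∫ y, v t y l * φ y| ≤
          C' * ∫ ξ : EuclideanSpace ℝ (Fin 3), ‖𝓕 (fun x => (φ x : ℂ)) ξ‖ / ‖ξ‖ ^ 2) →
      ∀ t < 0, ∀ x, v t x = 0) :
    (∀ v : ℝ → EuclideanSpace ℝ (Fin 3) → EuclideanSpace ℝ (Fin 3),
      Literature.Analysis.FluidPDE.IsBoundedAncientMildSolution 1 v →
      ContDiffOn ℝ (⊤ : ℕ∞) (uncurry v) (Set.Iio 0 ×ˢ Set.univ) →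
      (∀ s t : ℝ, s < t → t < 0 → ∀ x,
        v t x = UnboundedOperators.heatExtension (v s) (t - s) x -
          Literature.Analysis.FluidPDE.oseenDuhamel 1 s v v t x) →
      (∃ M' : ℝ, ∀ t < 0, ∀ (y : EuclideanSpace ℝ (Fin 3)) (r : ℝ), 0 < r →
        ∫ x in Metric.ball y r, ‖v t x‖ ^ 2 ≤ M' * r) →
      (∃ C' : ℝ, ∀ t < 0, ∀ (l : Fin 3) (φ : EuclideanSpace ℝ (Fin 3) → ℝ),
        MeasureTheory.Integrable φ →
        MeasureTheory.Integrable (fun ξ : EuclideanSpace ℝ (Fin 3) =>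
          ‖FourierTransform.fourier (fun x => (φ x : ℂ)) ξ‖ / ‖ξ‖ ^ 2) →
        |∫ y, v t y l * φ y| ≤
          C' * ∫ ξ : EuclideanSpace ℝ (Fin 3), ‖FourierTransform.fourier (fun x => (φ x : ℂ)) ξ‖ / ‖ξ‖ ^ 2) →
      ∀ t < 0, ∀ x, v t x = 0) :=
  fun v hv hsm hoseen _ hPM => h2 v hv hsm hoseen hPM

/-- **(L_PM) ⇒ (L_PM2)**: the Morrey hypothesis of (L_PM) is supplied by the dual `PM²` bound
(`stub_morreyOfPMDual`, `PM² ⊂ Ṁ^{2,1}`). [cite: LemarieRieusset2016, §8.5] -/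
theorem liouvillePM2_of_liouvillePM
    (h : ∀ v : ℝ → EuclideanSpace ℝ (Fin 3) → EuclideanSpace ℝ (Fin 3),
      Literature.Analysis.FluidPDE.IsBoundedAncientMildSolution 1 v →
      ContDiffOn ℝ (⊤ : ℕ∞) (uncurry v) (Set.Iio 0 ×ˢ Set.univ) →
      (∀ s t : ℝ, s < t → t < 0 → ∀ x,
        v t x = UnboundedOperators.heatExtension (v s) (t - s) x -
          Literature.Analysis.FluidPDE.oseenDuhamel 1 s v v t x) →
      (∃ M' : ℝ, ∀ t < 0, ∀ (y : EuclideanSpace ℝ (Fin 3)) (r : ℝ), 0 < r →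
        ∫ x in Metric.ball y r, ‖v t x‖ ^ 2 ≤ M' * r) →
      (∃ C' : ℝ, ∀ t < 0, ∀ (l : Fin 3) (φ : EuclideanSpace ℝ (Fin 3) → ℝ),
        MeasureTheory.Integrable φ →
        MeasureTheory.Integrable (fun ξ : EuclideanSpace ℝ (Fin 3) =>
          ‖FourierTransform.fourier (fun x => (φ x : ℂ)) ξ‖ / ‖ξ‖ ^ 2) →
        |∫ y, v t y l * φ y| ≤
          C' * ∫ ξ : EuclideanSpace ℝ (Fin 3), ‖FourierTransform.fourier (fun x => (φ x : ℂ)) ξ‖ / ‖ξ‖ ^ 2) →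
      ∀ t < 0, ∀ x, v t x = 0) :
    (∀ v : ℝ → EuclideanSpace ℝ (Fin 3) → EuclideanSpace ℝ (Fin 3),
      IsBoundedAncientMildSolution 1 v →
      ContDiffOn ℝ (⊤ : ℕ∞) (uncurry v) (Set.Iio 0 ×ˢ Set.univ) →
      (∀ s t : ℝ, s < t → t < 0 → ∀ x,
        v t x = UnboundedOperators.heatExtension (v s) (t - s) x - oseenDuhamel 1 s v v t x) →
      (∃ C' : ℝ, ∀ t < 0, ∀ (l : Fin 3) (φ : EuclideanSpace ℝ (Fin 3) → ℝ), Integrable φ →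
        Integrable (fun ξ : EuclideanSpace ℝ (Fin 3) => ‖𝓕 (fun x => (φ x : ℂ)) ξ‖ / ‖ξ‖ ^ 2) →
        |∫ y, v t y l * φ y| ≤
          C' * ∫ ξ : EuclideanSpace ℝ (Fin 3), ‖𝓕 (fun x => (φ x : ℂ)) ξ‖ / ‖ξ‖ ^ 2) →
      ∀ t < 0, ∀ x, v t x = 0) :=
  fun v hv hsm hoseen hPM => h v hv hsm hoseen (stub_morreyOfPMDual v hv hsm hPM) hPM

/-- **(L_M) ⇒ (L_PM2)**: every bridge into the Morrey–Liouville statement (L_M) of reshape r3 —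
(L) of KNSS 2009 (item stmt-NavierStokesRegularity-10661), `¬ LocalTypeISingularityExists`
(item stmt-NavierStokesRegularity-10480), the small-constant and axisymmetric regimes — is a
bridge into (L_PM2). [folklore] -/
theorem liouvillePM2_of_liouvilleMorrey
    (hLM : ∀ v : ℝ → EuclideanSpace ℝ (Fin 3) → EuclideanSpace ℝ (Fin 3),
      IsBoundedAncientMildSolution 1 v →
      ContDiffOn ℝ (⊤ : ℕ∞) (uncurry v) (Set.Iio 0 ×ˢ Set.univ) →
      (∀ s t : ℝ, s < t → t < 0 → ∀ x,
        v t x = UnboundedOperators.heatExtension (v s) (t - s) x - oseenDuhamel 1 s v v t x) →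
      (∃ M' : ℝ, ∀ t < 0, ∀ (y : EuclideanSpace ℝ (Fin 3)) (r : ℝ), 0 < r →
        ∫ x in Metric.ball y r, ‖v t x‖ ^ 2 ≤ M' * r) →
      ∀ t < 0, ∀ x, v t x = 0) :
    (∀ v : ℝ → EuclideanSpace ℝ (Fin 3) → EuclideanSpace ℝ (Fin 3),
      IsBoundedAncientMildSolution 1 v →
      ContDiffOn ℝ (⊤ : ℕ∞) (uncurry v) (Set.Iio 0 ×ˢ Set.univ) →
      (∀ s t : ℝ, s < t → t < 0 → ∀ x,
        v t x = UnboundedOperators.heatExtension (v s) (t - s) x - oseenDuhamel 1 s v v t x) →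
      (∃ C' : ℝ, ∀ t < 0, ∀ (l : Fin 3) (φ : EuclideanSpace ℝ (Fin 3) → ℝ), Integrable φ →
        Integrable (fun ξ : EuclideanSpace ℝ (Fin 3) => ‖𝓕 (fun x => (φ x : ℂ)) ξ‖ / ‖ξ‖ ^ 2) →
        |∫ y, v t y l * φ y| ≤
          C' * ∫ ξ : EuclideanSpace ℝ (Fin 3), ‖𝓕 (fun x => (φ x : ℂ)) ξ‖ / ‖ξ‖ ^ 2) →
      ∀ t < 0, ∀ x, v t x = 0) :=
  liouvillePM2_of_liouvillePM (liouvillePM_of_liouvilleMorrey hLM)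

/-! ### The crux from (L_PM2) -/

/-- **Crux (B) of route `FrozenSignCascade` from the Liouville statement on `L^∞_t PM²_x`**
(reshape r5): the composition `stub_ofLiouvillePM` of reshape r4 with the trivial direction
`liouvillePM_of_liouvillePM2`. [cite: KochNadirashviliSereginSverak2009, Lemma 6.1 and Prop. 4.1 (arXiv:0709.3599)] -/
theorem boundedEnvelopeContinuation_of_liouvillePM2
    (h2 : ∀ v : ℝ → EuclideanSpace ℝ (Fin 3) → EuclideanSpace ℝ (Fin 3),
      IsBoundedAncientMildSolution 1 v →
      ContDiffOn ℝ (⊤ : ℕ∞) (uncurry v) (Set.Iio 0 ×ˢ Set.univ) →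
      (∀ s t : ℝ, s < t → t < 0 → ∀ x,
        v t x = UnboundedOperators.heatExtension (v s) (t - s) x - oseenDuhamel 1 s v v t x) →
      (∃ C' : ℝ, ∀ t < 0, ∀ (l : Fin 3) (φ : EuclideanSpace ℝ (Fin 3) → ℝ), Integrable φ →
        Integrable (fun ξ : EuclideanSpace ℝ (Fin 3) => ‖𝓕 (fun x => (φ x : ℂ)) ξ‖ / ‖ξ‖ ^ 2) →
        |∫ y, v t y l * φ y| ≤
          C' * ∫ ξ : EuclideanSpace ℝ (Fin 3), ‖𝓕 (fun x => (φ x : ℂ)) ξ‖ / ‖ξ‖ ^ 2) →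
      ∀ t < 0, ∀ x, v t x = 0) :
    Summit.NavierStokesRegularity.NavierStokesRegularity.Theses.FrozenSignCascade.BoundedEnvelopeContinuation :=
  stub_ofLiouvillePM (liouvillePM_of_liouvillePM2 h2)

/-- **Registered stub `stub_ofLiouvillePM2` of the reshaped skeleton (r5)**: the implication
(L_PM2) ⇒ `BoundedEnvelopeContinuation`, by name, so that the skeleton's composition
`BoundedEnvelopeContinuation_of := stub_ofLiouvillePM2 stub_liouvillePM2` is closed modulo the
single open stub `stub_liouvillePM2` (L_PM2).
[cite: KochNadirashviliSereginSverak2009, Lemma 6.1 and Prop. 4.1 (arXiv:0709.3599)] -/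
theorem stub_ofLiouvillePM2 :
    (∀ v : ℝ → EuclideanSpace ℝ (Fin 3) → EuclideanSpace ℝ (Fin 3),
      Literature.Analysis.FluidPDE.IsBoundedAncientMildSolution 1 v →
      ContDiffOn ℝ (⊤ : ℕ∞) (uncurry v) (Set.Iio 0 ×ˢ Set.univ) →
      (∀ s t : ℝ, s < t → t < 0 → ∀ x,
        v t x = UnboundedOperators.heatExtension (v s) (t - s) x -
          Literature.Analysis.FluidPDE.oseenDuhamel 1 s v v t x) →
      (∃ C' : ℝ, ∀ t < 0, ∀ (l : Fin 3) (φ : EuclideanSpace ℝ (Fin 3) → ℝ),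
        MeasureTheory.Integrable φ →
        MeasureTheory.Integrable (fun ξ : EuclideanSpace ℝ (Fin 3) =>
          ‖FourierTransform.fourier (fun x => (φ x : ℂ)) ξ‖ / ‖ξ‖ ^ 2) →
        |∫ y, v t y l * φ y| ≤
          C' * ∫ ξ : EuclideanSpace ℝ (Fin 3), ‖FourierTransform.fourier (fun x => (φ x : ℂ)) ξ‖ / ‖ξ‖ ^ 2) →
      ∀ t < 0, ∀ x, v t x = 0) →
    Summit.NavierStokesRegularity.NavierStokesRegularity.Theses.FrozenSignCascade.BoundedEnvelopeContinuation :=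
  boundedEnvelopeContinuation_of_liouvillePM2

/-! ### (L_PM2) for a small pseudo-measure constant -/

/-- **(L_PM2) for a SMALL pseudo-measure constant** (the Liouville form of the Le Jan–Sznitman /
Cannone–Karch small-data uniqueness in `PM²`, obtained here through the embedding
`PM² ⊂ Ṁ^{2,1}` and lead c3's `liouvilleMorrey_small`): there is a universal `ε₀ > 0` such that
every bounded ancient mild solution (`ν = 1`), jointly smooth and Oseen-mild on `(-∞,0) × ℝ³`,
whose slices obey the dual `PM²` bound with constant `ε₀` at all negative times, vanishes
identically. Equivalently: a NONTRIVIAL bounded ancient mild solution has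
`sup_{t<0} ‖v(t)‖_{PM²} > ε₀`.
[cite: CaffarelliKohnNirenberg1982, Prop. 1; LemarieRieusset2016, §8.5 and Thm 14.4] -/
theorem liouvillePM2_small : ∃ ε₀ : ℝ, 0 < ε₀ ∧
    ∀ v : ℝ → EuclideanSpace ℝ (Fin 3) → EuclideanSpace ℝ (Fin 3),
      IsBoundedAncientMildSolution 1 v →
      ContDiffOn ℝ (⊤ : ℕ∞) (uncurry v) (Set.Iio 0 ×ˢ Set.univ) →
      (∀ s t : ℝ, s < t → t < 0 → ∀ x,
        v t x = UnboundedOperators.heatExtension (v s) (t - s) x - oseenDuhamel 1 s v v t x) →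
      (∀ t < 0, ∀ (l : Fin 3) (φ : EuclideanSpace ℝ (Fin 3) → ℝ), Integrable φ →
        Integrable (fun ξ : EuclideanSpace ℝ (Fin 3) => ‖𝓕 (fun x => (φ x : ℂ)) ξ‖ / ‖ξ‖ ^ 2) →
        |∫ y, v t y l * φ y| ≤
          ε₀ * ∫ ξ : EuclideanSpace ℝ (Fin 3), ‖𝓕 (fun x => (φ x : ℂ)) ξ‖ / ‖ξ‖ ^ 2) →
      ∀ t < 0, ∀ x, v t x = 0 := by
  obtain ⟨M₀, hM₀, H⟩ := liouvilleMorrey_small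
  -- the embedding constant `κ = 54|B₁|³ + 18|B₁|` and the threshold `ε₀ = √(M₀/(κ+1))`
  obtain ⟨κ, hκ⟩ : ∃ κ : ℝ, κ = 54 * (volume (ball (0 : EuclideanSpace ℝ (Fin 3)) 1)).toReal ^ 3 +
      18 * (volume (ball (0 : EuclideanSpace ℝ (Fin 3)) 1)).toReal := ⟨_, rfl⟩
  have hκ0 : 0 ≤ κ := by rw [hκ]; positivity
  refine ⟨Real.sqrt (M₀ / (κ + 1)), Real.sqrt_pos.2 (div_pos hM₀ (by linarith)), ?_⟩
  intro v hv hsm hoseen hPM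
  have hε0 : 0 ≤ Real.sqrt (M₀ / (κ + 1)) := Real.sqrt_nonneg _
  have hε2 : Real.sqrt (M₀ / (κ + 1)) ^ 2 = M₀ / (κ + 1) :=
    Real.sq_sqrt (div_nonneg hM₀.le (by linarith))
  have hκε : κ * Real.sqrt (M₀ / (κ + 1)) ^ 2 ≤ M₀ := by
    rw [hε2, mul_div_assoc']
    rw [div_le_iff₀ (by linarith : (0:ℝ) < κ + 1)]
    nlinarith
  obtain ⟨B, hB⟩ := hv.isBoundedOn
  have hcont : ∀ t < 0, Continuous (v t) := fun t ht =>
    hsm.continuousOn.comp_continuous (continuous_const.prodMk continuous_id)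
      fun x => ⟨ht, Set.mem_univ x⟩
  have hMor : ∀ t < 0, ∀ (y : EuclideanSpace ℝ (Fin 3)) (r : ℝ), 0 < r →
      ∫ x in Metric.ball y r, ‖v t x‖ ^ 2 ≤ M₀ * r := by
    intro t ht y r hr
    have h := setIntegral_ball_norm_sq_le_of_pmDual hε0 (hcont t ht).aestronglyMeasurable
      (fun x => hB t ht x) (hPM t ht) y hr
    rw [← hκ] at h
    calc ∫ x in Metric.ball y r, ‖v t x‖ ^ 2 ≤ κ * Real.sqrt (M₀ / (κ + 1)) ^ 2 * r := h
      _ ≤ M₀ * r := mul_le_mul_of_nonneg_right hκε hr.le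
  exact H v hv hsm hoseen hMor

end Summit.NavierStokesRegularity.NavierStokesRegularity.Theorems.BoundedEnvelope

end
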